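import Literature.MathematicalPhysics.QuantumLattice.GrassmannIntegralWilsonProofs
import Literature.MathematicalPhysics.QuantumLattice.WilsonFermionBlockAveraging
import Literature.MathematicalPhysics.QuantumFieldTheory.LatticeGaugeProofs
import HarnessLib

/-!
# The Wilson–Dirac operator with antiperiodic quarks on the four-torus

Definition request `defn-wilsonDiracAP` (route `QuantumFields/QCD/QuarksAsStableAction`, items
stmt-QuantumFields-9734/9735/9736/9738/9740, which inline these objects with `let`).

## Content

* `unitaryLift U` — the edgewise inclusion `SU(N) ↪ U(N)` of a lattice gauge field on the torus
  `(ℤ/Lℤ)^d` (`GaugeConfig d L`); `apTwistAt s V` — the sign twist of a `U(N)` field negating, in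
  every direction `μ`, the links leaving the slice `x_μ = s μ` (the *seam*); `apLift U` — the
  **antiperiodic lift** (seams at the last slice `x_μ = -1`), written as the literal `if` of the
  route so that `apLift U` is *definitionally* the helper inlined there
  (`apLift_eq_apTwistAt : apLift U = apTwistAt (fun _ => -1) (unitaryLift U)`).
* `wilsonDiracAP U m := wilsonDirac (unitaryFundamentalRep (Fin N) ℂ) (apLift U) m 1` — the
  `r = 1` Wilson–Dirac operator of the `SU(N)` field `U` with fermionic boundary conditions
  ANTIPERIODIC in all four directions (the tree's `wilsonDirac` is periodic; coupling it to the
  sign-twisted `U(N)` field is the same as imposing Montvay–Münster's boundary sign factors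
  `b_x^± = -1`, (4.112)–(4.114), in every direction).  Antiperiodicity is the boundary condition
  produced by the trace, (4.34), under which the Osterwalder–Seiler/Lüscher transfer-matrix and
  reflection-positivity constructions apply on the torus (§4.2.3).
* `plaquetteDeficit ρ U p := N - Re tr ρ(U_p)` (`wilsonAction ρ U = ∑ₚ plaquetteDeficit ρ U p`,
  `wilsonAction_eq_sum_plaquetteDeficit`, by `rfl`), the number `badCount ρ δ U` of `δ`-bad
  plaquettes (deficit `≥ δ`) and the Wilson action `goodAction ρ δ U` of the `δ`-good ones
  (deficit `< δ`), with `goodAction_add_sum_bad`, `mul_badCount_le`, `0 ≤ deficit ≤ 2N` for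
  unitary `ρ`.

## API (all proved)

* **Reality**: `γ₅ D_AP γ₅ = D_AP†` and `Im det D_AP = 0` (`wilsonDiracAP_gammaFive_hermitian`,
  `fermionDet_wilsonDiracAP_im`, from the tree's discharged `γ₅`-hermiticity, the `U(N)` links
  being unitary).
* **Gauge invariance** of `det D_W` (any `G`, `ρ`; `fermionDet_wilsonDirac_gaugeTransform`, from
  the tree's gauge covariance `wilsonDirac_gaugeTransform` of `WilsonFermionBlockAveraging`) and
  of `det D_AP` (`apLift_gaugeTransform`, `fermionDet_wilsonDiracAP_gaugeTransform`,
  `isGaugeInvariant_fermionDet_wilsonDiracAP`).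
* **Seam independence** `fermionDet_wilsonDirac_apTwistAt`: `det D_W` of the twisted field does
  not depend on where the seams are — moving one seam by one slice is the `{±1} ⊂ U(N)` gauge
  transformation `sliceSign` (`apTwistAt_update_succ`), iterated along each direction.
* **Reflections** `wilsonDirac_reflect`: for an involution `θ` of the sites reversing the time
  shift and commuting with the spatial ones, `D_W` of the reflected field is `D_W[U]` reindexed by
  `(x, a, α) ↦ (θ x, a, 3 - α)` (the spin flip is `σˣ ⊗ σˣ ∝ γ₀γ₅` in the chiral basis,
  `euclideanGamma_rev_rev`); hence `det D_W` and `det D_AP` are invariant under the link reflection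
  `GaugeConfig.timeReflect` and under the site reflection `(torusConfigShift ê₀ U).timeReflect`
  of `TorusSiteRP` (`fermionDet_wilsonDiracAP_timeReflect`, `fermionDet_wilsonDiracAP_siteReflect`;
  the reflected antiperiodic field is the antiperiodic lift of the reflected field up to a seam
  relocation, `apTwistAt_timeReflect`), and under translations
  (`fermionDet_wilsonDiracAP_torusConfigShift`, `apTwistAt_torusConfigShift`).

Not here: invertibility of the free antiperiodic operator `wilsonDiracAP 1 m` on even tori
(Montvay–Münster (4.119)–(4.124): antiperiodic momenta have `∑_μ sin² p_μ > 0`).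

## Sources

I. Montvay, G. Münster, *Quantum Fields on a Lattice* (CUP 1994): §4.1.3 (4.34) (trace ⇔
antiperiodic Grassmann variables; held copy PDF pp. 169–170), §4.2.2 (4.85)–(4.89) (Wilson
fermion matrix), §4.2.3 (4.91), (4.99)–(4.111) (link and site reflections), §4.2.4
(4.112)–(4.114) (periodic/antiperiodic sign factors `b_x^±`; PDF p. 185), (4.119) (antiperiodic
momenta; p. 186), §5.1.1 (5.3)–(5.5) (gauge transformations, Wilson quark action), §5.1.2
(5.15)–(5.16) (`γ₅`-hermiticity, real determinant), App. 8.1.2 (8.8)–(8.10) (chiral `γ`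
matrices); K. Osterwalder, E. Seiler, Ann. Phys. 110 (1978) 440, §2 (reflections of lattice
gauge fields with fermions); M. Lüscher, Commun. Math. Phys. 54 (1977) 283 (transfer matrix for
Wilson fermions).

## Design choices

* `apLift` keeps the literal form of the route (`rfl`-restatable); the structural lemmas are
  proved for the primitive `apTwistAt s V` on `U(N)` fields with arbitrary seams `s`, to which
  `apLift` reduces by `rfl`.
* The seam-relocation gauge transformation is built one slice at a time (`sliceSign`), which
  avoids `ZMod.val` arithmetic and holds for every `L` (for `L = 1` the flip is trivial).
* Reflections and translations are phrased through `Matrix.submatrix` along an explicit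
  permutation (`reflectEquiv`), so that determinant invariance is
  `Matrix.det_submatrix_equiv_self`; gauge covariance is imported, not redone.
-/

noncomputable section

open Matrix Complex Finset

namespace Literature.MathematicalPhysics.QuantumLattice

section QLatticeAQFT

open Literature.Probability.LatticeModels QuantumFieldTheory

variable {d L N : ℕ}

local notation "𝕌" => Matrix.unitaryGroup (Fin N) ℂ
local notation "𝕊𝕌" => Matrix.specialUnitaryGroup (Fin N) ℂ

/-! ### The antiperiodic `U(N)` lift of an `SU(N)` gauge field -/

/-- The edgewise inclusion `SU(N) ↪ U(N)` of a lattice gauge field. [folklore] -/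
def unitaryLift (U : GaugeConfig d L 𝕊𝕌) : GaugeConfig d L 𝕌 :=
  fun e => ⟨(U e).1, Matrix.specialUnitaryGroup_le_unitaryGroup (U e).2⟩

/-- The sign twist of a `U(N)` gauge field implementing fermionic boundary conditions that are
ANTIPERIODIC in every direction, with the seam in direction `μ` placed on the links leaving the
slice `x_μ = s μ`: those links are multiplied by `-1 ∈ U(N)` (Montvay–Münster's boundary sign
factors `b_x^± = -1` on the hops crossing the seam, (4.112)–(4.114), here in all four
directions). [cite: MontvayMunster1994, §4.2.4 (4.112)–(4.114)] -/
def apTwistAt (s : Fin d → ZMod L) (V : GaugeConfig d L 𝕌) : GaugeConfig d L 𝕌 :=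
  fun e => if e.1 e.2 = s e.2 then -V e else V e

/-- **The antiperiodic lift** `SU(N) → U(N)` of a lattice gauge field on the torus `(ℤ/Lℤ)^d`:
the link variables leaving the last slice `x_μ = -1 (= L - 1)` in their own direction `μ` are
negated in `U(N)`, all other links are included unchanged.  Coupling Wilson fermions to
`apLift U` through the defining representation of `U(N)` is the same as coupling them to `U`
with antiperiodic boundary conditions in all `d` directions (Montvay–Münster §4.2.4,
(4.112)–(4.114): the sign factors `b⁺_x = -1` for `x_μ = L_μ - 1`; antiperiodicity is the
boundary condition produced by the trace, §4.1.3 (4.34)).  Written as a literal `if` so that it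
is definitionally the helper inlined in route QuarksAsStableAction. [cite: MontvayMunster1994, §4.2.4 (4.112)–(4.114)] -/
def apLift (U : GaugeConfig d L 𝕊𝕌) : GaugeConfig d L 𝕌 :=
  fun e => if e.1 e.2 = -1 then -⟨(U e).1, Matrix.specialUnitaryGroup_le_unitaryGroup (U e).2⟩
    else ⟨(U e).1, Matrix.specialUnitaryGroup_le_unitaryGroup (U e).2⟩

/-- **The Wilson–Dirac operator with antiperiodic quarks** on the four-torus `(ℤ/Lℤ)⁴`, Wilson
parameter `r = 1`, bare mass `m`, colour group `SU(N)` in the defining representation: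
the tree's (periodic) `wilsonDirac` of the antiperiodic `U(N)` lift `apLift U`
(Montvay–Münster §4.2.2 (4.85)–(4.89) with the boundary sign factors of §4.2.4 (4.112)–(4.114)
in all four directions, colour-gauged as in §5.1.1 (5.5)). [cite: MontvayMunster1994, §4.2.4 (4.112)–(4.114) and §5.1.1 (5.5)] -/
def wilsonDiracAP (U : GaugeConfig 4 L 𝕊𝕌) (m : ℝ) :
    Matrix (TorusSite 4 L × Fin N × Fin 4) (TorusSite 4 L × Fin N × Fin 4) ℂ :=
  wilsonDirac (unitaryFundamentalRep (Fin N) ℂ) (apLift U) m 1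

/-! ### Plaquette deficits, bad plaquettes, good action -/

section Deficit

variable {G : Type*} [Group G] (ρ : G →* Matrix (Fin N) (Fin N) ℂ)

/-- The plaquette deficit `N - Re tr ρ(U_p)` of the plaquette `p` (the summand of the Wilson
action `wilsonAction ρ U = ∑ₚ (N - Re tr ρ(U_p))`; Wilson 1974). [folklore] -/
def plaquetteDeficit (U : GaugeConfig d L G) (p : Plaquette d L) : ℝ :=
  (N : ℝ) - (ρ (plaquetteHolonomy U p.1 p.2.1.1 p.2.1.2)).trace.re

/-- The number of `δ`-bad plaquettes (deficit at least `δ`) of a gauge field. [folklore] -/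
def badCount [NeZero L] (δ : ℝ) (U : GaugeConfig d L G) : ℕ :=
  (univ.filter fun p => δ ≤ plaquetteDeficit ρ U p).card

/-- The Wilson action of the `δ`-good plaquettes (deficit below `δ`) of a gauge field. [folklore] -/
def goodAction [NeZero L] (δ : ℝ) (U : GaugeConfig d L G) : ℝ :=
  ∑ p ∈ univ.filter (fun p => plaquetteDeficit ρ U p < δ), plaquetteDeficit ρ U p

/-- The Wilson action is the sum of the plaquette deficits. [folklore] -/
theorem wilsonAction_eq_sum_plaquetteDeficit [NeZero L] (U : GaugeConfig d L G) :
    wilsonAction ρ U = ∑ p, plaquetteDeficit ρ U p := rfl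

/-- The Wilson action splits into the good action and the action of the bad plaquettes. [folklore] -/
theorem goodAction_add_sum_bad [NeZero L] (δ : ℝ) (U : GaugeConfig d L G) :
    goodAction ρ δ U + ∑ p ∈ univ.filter (fun p => δ ≤ plaquetteDeficit ρ U p),
      plaquetteDeficit ρ U p = wilsonAction ρ U := by
  rw [goodAction, wilsonAction_eq_sum_plaquetteDeficit]
  have h := Finset.sum_filter_add_sum_filter_not (s := (univ : Finset (Plaquette d L)))
    (p := fun p => plaquetteDeficit ρ U p < δ) (f := fun p => plaquetteDeficit ρ U p)
  rw [← h]
  congr 2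
  ext p
  simp [not_lt]

/-- The bad plaquettes carry at least `δ` each: `δ · badCount ≤ ∑_{bad} deficit`. [folklore] -/
theorem mul_badCount_le [NeZero L] (δ : ℝ) (U : GaugeConfig d L G) :
    δ * badCount ρ δ U ≤ ∑ p ∈ univ.filter (fun p => δ ≤ plaquetteDeficit ρ U p),
      plaquetteDeficit ρ U p := by
  rw [badCount, mul_comm, ← nsmul_eq_mul, ← Finset.sum_const]
  exact Finset.sum_le_sum fun p hp => (Finset.mem_filter.1 hp).2

/-- For a representation by unitary matrices the plaquette deficit is non-negative
(`Re tr V ≤ N` for `V ∈ U(N)`, every entry having norm at most `1`). [folklore] -/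
theorem plaquetteDeficit_nonneg (hρ : ∀ g, ρ g ∈ Matrix.unitaryGroup (Fin N) ℂ)
    (U : GaugeConfig d L G) (p : Plaquette d L) : 0 ≤ plaquetteDeficit ρ U p := by
  rw [plaquetteDeficit, sub_nonneg, Matrix.trace, Complex.re_sum]
  calc ∑ i, (Matrix.diag (ρ (plaquetteHolonomy U p.1 p.2.1.1 p.2.1.2)) i).re
      ≤ ∑ _i : Fin N, (1 : ℝ) := Finset.sum_le_sum fun i _ =>
        (Complex.re_le_norm _).trans (entry_norm_bound_of_unitary (hρ _) i i)
    _ = N := by simp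

/-- ... and at most `2N` (`Re tr V ≥ -N`). [folklore] -/
theorem plaquetteDeficit_le (hρ : ∀ g, ρ g ∈ Matrix.unitaryGroup (Fin N) ℂ)
    (U : GaugeConfig d L G) (p : Plaquette d L) : plaquetteDeficit ρ U p ≤ 2 * N := by
  rw [plaquetteDeficit, two_mul, Matrix.trace, Complex.re_sum]
  have : -∑ i, (Matrix.diag (ρ (plaquetteHolonomy U p.1 p.2.1.1 p.2.1.2)) i).re ≤ (N : ℝ) := by
    rw [← Finset.sum_neg_distrib]
    calc ∑ i, -(Matrix.diag (ρ (plaquetteHolonomy U p.1 p.2.1.1 p.2.1.2)) i).re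
        ≤ ∑ _i : Fin N, (1 : ℝ) := Finset.sum_le_sum fun i _ => by
          exact (neg_le_abs _).trans
            ((Complex.abs_re_le_norm _).trans (entry_norm_bound_of_unitary (hρ _) i i))
      _ = N := by simp
  linarith

end Deficit

/-! ### Unfolding lemmas -/

section Unfold

/-- The inclusion `SU(N) →* U(N)` (Mathlib's `Submonoid.inclusion`). [folklore] -/
abbrev suInclusion : 𝕊𝕌 →* 𝕌 :=
  Submonoid.inclusion Matrix.specialUnitaryGroup_le_unitaryGroup

/-- The plain lift is the inclusion hom, edgewise. [folklore] -/
theorem unitaryLift_apply (U : GaugeConfig d L 𝕊𝕌) (e : Edge d L) :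
    unitaryLift U e = suInclusion (N := N) (U e) := rfl

/-- The plain lift does not change the underlying matrices. [folklore] -/
@[simp] theorem coe_unitaryLift_apply (U : GaugeConfig d L 𝕊𝕌) (e : Edge d L) :
    ((unitaryLift U e : 𝕌) : Matrix (Fin N) (Fin N) ℂ) = (U e : Matrix (Fin N) (Fin N) ℂ) := rfl

/-- Unfolding of the sign twist. [folklore] -/
theorem apTwistAt_apply (s : Fin d → ZMod L) (V : GaugeConfig d L 𝕌) (e : Edge d L) :
    apTwistAt s V e = if e.1 e.2 = s e.2 then -V e else V e := rfl

/-- Unfolding of the antiperiodic lift through the plain lift. [folklore] -/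
theorem apLift_apply (U : GaugeConfig d L 𝕊𝕌) (e : Edge d L) :
    apLift U e = if e.1 e.2 = -1 then -unitaryLift U e else unitaryLift U e := rfl

/-- The antiperiodic lift is the sign twist, with all seams at the last slice `-1`, of the plain
`U(N)` lift. [folklore] -/
theorem apLift_eq_apTwistAt (U : GaugeConfig d L 𝕊𝕌) :
    apLift U = apTwistAt (fun _ => -1) (unitaryLift U) := rfl

/-- The underlying matrices of the antiperiodic lift: `-U e` on the seam links, `U e` elsewhere. [folklore] -/
theorem coe_apLift_apply (U : GaugeConfig d L 𝕊𝕌) (e : Edge d L) :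
    ((apLift U e : 𝕌) : Matrix (Fin N) (Fin N) ℂ) =
      if e.1 e.2 = -1 then -(U e : Matrix (Fin N) (Fin N) ℂ) else (U e : Matrix (Fin N) (Fin N) ℂ) := by
  rw [apLift_apply]
  split_ifs <;> rfl

/-- Unfolding of `wilsonDiracAP`. [folklore] -/
theorem wilsonDiracAP_def (U : GaugeConfig 4 L 𝕊𝕌) (m : ℝ) :
    wilsonDiracAP U m = wilsonDirac (unitaryFundamentalRep (Fin N) ℂ) (apLift U) m 1 := rfl

/-- The defining representation of `U(N)` takes values in `U(N)`. [folklore] -/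
theorem unitaryFundamentalRep_mem_unitaryGroup (g : 𝕌) :
    unitaryFundamentalRep (Fin N) ℂ g ∈ Matrix.unitaryGroup (Fin N) ℂ := g.2

end Unfold

/-! ### Reality of the antiperiodic fermion determinant -/

section Reality

variable [NeZero L]

/-- **γ₅-hermiticity survives the antiperiodic `U(N)` lift**: `γ₅ D_AP γ₅ = D_AP†`
(Montvay–Münster (5.15), for any links in `U(N)`). [cite: MontvayMunster1994, §5.1.2 (5.15)] -/
theorem wilsonDiracAP_gammaFive_hermitian (U : GaugeConfig 4 L 𝕊𝕌) (m : ℝ) :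
    spinorLift gammaFive * wilsonDiracAP U m * spinorLift gammaFive = (wilsonDiracAP U m)ᴴ :=
  wilsonDirac_gammaFive_hermitian_holds _ unitaryFundamentalRep_mem_unitaryGroup _ m 1

/-- **The antiperiodic Wilson fermion determinant is real** (Montvay–Münster (5.16)). [cite: MontvayMunster1994, §5.1.2 (5.16)] -/
theorem fermionDet_wilsonDiracAP_im (U : GaugeConfig 4 L 𝕊𝕌) (m : ℝ) :
    (fermionDet (wilsonDiracAP U m)).im = 0 :=
  fermionDet_wilsonDirac_im_holds _ unitaryFundamentalRep_mem_unitaryGroup _ m 1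

/-- `conj det D_AP = det D_AP`. [cite: MontvayMunster1994, §5.1.2 (5.16)] -/
theorem star_fermionDet_wilsonDiracAP (U : GaugeConfig 4 L 𝕊𝕌) (m : ℝ) :
    star (fermionDet (wilsonDiracAP U m)) = fermionDet (wilsonDiracAP U m) :=
  Complex.conj_eq_iff_im.2 (fermionDet_wilsonDiracAP_im U m)

/-- `det D_AP` is the complexification of its real part. [cite: MontvayMunster1994, §5.1.2 (5.16)] -/
theorem fermionDet_wilsonDiracAP_eq_re (U : GaugeConfig 4 L 𝕊𝕌) (m : ℝ) :
    fermionDet (wilsonDiracAP U m) = ((fermionDet (wilsonDiracAP U m)).re : ℂ) :=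
  (Complex.conj_eq_iff_re.1 (star_fermionDet_wilsonDiracAP U m)).symm

end Reality

/-! ### Gauge invariance of the Wilson fermion determinant -/

section GaugeDet

variable {G : Type*} [Group G] (ρ : G →* Matrix (Fin N) (Fin N) ℂ) [NeZero L]

/-- **Gauge invariance of the Wilson fermion determinant**: `det D_W[U^g] = det D_W[U]` for every
gauge transformation `g : Λ → G` (any `G`, `ρ`, `m`, `r`), from the tree's gauge covariance
`wilsonDirac_gaugeTransform` (`D_W[U^g] = 𝒢(g) D_W[U] 𝒢(g)⁻¹`, Montvay–Münster §5.1.1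
(5.3)–(5.5)). [cite: MontvayMunster1994, §5.1.1 (5.3)–(5.5)] -/
theorem fermionDet_wilsonDirac_gaugeTransform (g : TorusSite 4 L → G) (U : GaugeConfig 4 L G)
    (m r : ℝ) :
    fermionDet (wilsonDirac ρ (gaugeTransform g U) m r) = fermionDet (wilsonDirac ρ U m r) := by
  have hdet : (gaugeRotation ρ (Fin 4) g⁻¹).det * (gaugeRotation ρ (Fin 4) g).det = 1 := by
    rw [← det_mul, gaugeRotation_inv_mul, det_one]
  change (wilsonDirac ρ (gaugeTransform g U) m r).det = (wilsonDirac ρ U m r).det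
  rw [wilsonDirac_gaugeTransform, det_mul, det_mul]
  calc (gaugeRotation ρ (Fin 4) g).det * (wilsonDirac ρ U m r).det *
        (gaugeRotation ρ (Fin 4) g⁻¹).det
      = (wilsonDirac ρ U m r).det *
          ((gaugeRotation ρ (Fin 4) g⁻¹).det * (gaugeRotation ρ (Fin 4) g).det) := by ring
    _ = (wilsonDirac ρ U m r).det := by rw [hdet, mul_one]

end GaugeDet

/-! ### Gauge invariance of the antiperiodic determinant -/

section GaugeAP

/-- The plain lift commutes with gauge transformations. [folklore] -/
theorem unitaryLift_gaugeTransform (g : TorusSite d L → 𝕊𝕌) (U : GaugeConfig d L 𝕊𝕌) :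
    unitaryLift (gaugeTransform g U) = gaugeTransform (fun x => suInclusion (N := N) (g x)) (unitaryLift U) := by
  funext e
  simp only [unitaryLift_apply, gaugeTransform, map_mul, map_inv]

/-- The antiperiodic sign twist commutes with gauge transformations (`-1` is central). [folklore] -/
theorem apTwistAt_gaugeTransform (s : Fin d → ZMod L) (g : TorusSite d L → 𝕌)
    (V : GaugeConfig d L 𝕌) :
    apTwistAt s (gaugeTransform g V) = gaugeTransform g (apTwistAt s V) := by
  funext e
  simp only [apTwistAt_apply, gaugeTransform]
  split_ifs
  · rw [mul_neg, neg_mul]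
  · rfl

/-- The antiperiodic lift intertwines `SU(N)` gauge transformations with the corresponding
`U(N)` gauge transformations. [folklore] -/
theorem apLift_gaugeTransform (g : TorusSite d L → 𝕊𝕌) (U : GaugeConfig d L 𝕊𝕌) :
    apLift (gaugeTransform g U) = gaugeTransform (fun x => suInclusion (N := N) (g x)) (apLift U) := by
  rw [apLift_eq_apTwistAt, apLift_eq_apTwistAt, unitaryLift_gaugeTransform, apTwistAt_gaugeTransform]

variable [NeZero L]

/-- **Gauge invariance of the antiperiodic Wilson fermion determinant.** [cite: MontvayMunster1994, §5.1.1 (5.3)–(5.5)] -/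
theorem fermionDet_wilsonDiracAP_gaugeTransform (g : TorusSite 4 L → 𝕊𝕌) (U : GaugeConfig 4 L 𝕊𝕌)
    (m : ℝ) : fermionDet (wilsonDiracAP (gaugeTransform g U) m) = fermionDet (wilsonDiracAP U m) := by
  rw [wilsonDiracAP_def, wilsonDiracAP_def, apLift_gaugeTransform]
  exact fermionDet_wilsonDirac_gaugeTransform _ _ _ _ _

/-- `U ↦ det D_AP[U, m]` is a gauge-invariant observable. [cite: MontvayMunster1994, §5.1.1 (5.3)–(5.5)] -/
theorem isGaugeInvariant_fermionDet_wilsonDiracAP (m : ℝ) :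
    IsGaugeInvariant fun U : GaugeConfig 4 L 𝕊𝕌 => fermionDet (wilsonDiracAP (N := N) U m) :=
  fun g U => fermionDet_wilsonDiracAP_gaugeTransform g U m

end GaugeAP

/-! ### Relocating the antiperiodic seams (a `ℤ₂ ⊂ U(N)` gauge transformation) -/

section Seam

/-- `(-1)⁻¹ = -1` in `U(N)`. [folklore] -/
theorem unitary_neg_one_inv : (-1 : 𝕌)⁻¹ = -1 :=
  inv_eq_of_mul_eq_one_right (by rw [neg_mul_neg, one_mul])

/-- `(-u)⁻¹ = -u⁻¹` in `U(N)`. [folklore] -/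
theorem unitary_neg_inv (u : 𝕌) : (-u)⁻¹ = -u⁻¹ :=
  inv_eq_of_mul_eq_one_right (by rw [neg_mul_neg, mul_inv_cancel])

/-- The `ℤ₂`-valued gauge function flipping the single slice `x_μ = c`. [folklore] -/
def sliceSign (μ : Fin d) (c : ZMod L) (x : TorusSite d L) : 𝕌 :=
  if x μ = c then -1 else 1

/-- The shift `x + μ̂` moves coordinate `μ` by one. [folklore] -/
private theorem shift_apply_self' (x : TorusSite d L) (μ : Fin d) :
    QuantumFieldTheory.Site.shift x μ μ = x μ + 1 := by
  simp [QuantumFieldTheory.Site.shift]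

/-- The shift `x + μ̂` fixes the other coordinates. [folklore] -/
private theorem shift_apply_of_ne' (x : TorusSite d L) {μ ν : Fin d} (h : ν ≠ μ) :
    QuantumFieldTheory.Site.shift x μ ν = x ν := by
  simp [QuantumFieldTheory.Site.shift, Pi.single_eq_of_ne h]

/-- **Flipping one slice** `x_μ = c` by the gauge transformation `sliceSign μ c` negates exactly
the `μ`-links entering or leaving that slice (exactly one of the two endpoints in the slice;
for `L = 1` both are and nothing happens). [folklore] -/
theorem gaugeTransform_sliceSign (μ : Fin d) (c : ZMod L) (V : GaugeConfig d L 𝕌) :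
    gaugeTransform (sliceSign (N := N) μ c) V =
      fun e => if e.2 = μ ∧ ¬(e.1 μ = c ↔ e.1 μ + 1 = c) then -V e else V e := by
  funext ⟨x, ν⟩
  simp only [gaugeTransform, sliceSign]
  by_cases hν : ν = μ
  · subst hν
    rw [shift_apply_self']
    by_cases h1 : x ν = c <;> by_cases h2 : x ν + 1 = c
    · rw [if_pos h1, if_pos h2, if_neg (fun h => h.2 (iff_of_true h1 h2)), unitary_neg_one_inv,
        neg_one_mul, mul_neg_one, neg_neg]
    · rw [if_pos h1, if_neg h2, if_pos ⟨rfl, fun h => h2 (h.1 h1)⟩, inv_one, mul_one, neg_one_mul]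
    · rw [if_neg h1, if_pos h2, if_pos ⟨rfl, fun h => h1 (h.2 h2)⟩, unitary_neg_one_inv, one_mul,
        mul_neg_one]
    · rw [if_neg h1, if_neg h2, if_neg (fun h => h.2 (iff_of_false h1 h2)), inv_one, mul_one,
        one_mul]
  · rw [shift_apply_of_ne' x (Ne.symm hν)]
    by_cases h1 : x μ = c
    · rw [if_pos h1, if_neg (fun h => hν h.1), unitary_neg_one_inv, neg_one_mul, mul_neg_one,
        neg_neg]
    · rw [if_neg h1, if_neg (fun h => hν h.1), inv_one, mul_one, one_mul]

/-- **Moving a seam by one slice is a `ℤ₂` gauge transformation**: the twist with the `μ`-seam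
at `s μ + 1` is the slice flip at `x_μ = s μ + 1` of the twist with the seam at `s μ`. [folklore] -/
theorem apTwistAt_update_succ (s : Fin d → ZMod L) (μ : Fin d) (V : GaugeConfig d L 𝕌) :
    apTwistAt (Function.update s μ (s μ + 1)) V =
      gaugeTransform (sliceSign μ (s μ + 1)) (apTwistAt s V) := by
  rw [gaugeTransform_sliceSign]
  funext ⟨x, ν⟩
  simp only [apTwistAt_apply]
  by_cases hν : ν = μ
  · subst hν
    rw [Function.update_self]
    by_cases h1 : x ν = s ν + 1 <;> by_cases h2 : x ν = s ν
    · rw [if_pos h1, if_pos h2, if_neg (fun h => h.2 (iff_of_true h1 (by rw [h2])))]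
    · rw [if_pos h1, if_neg h2, if_pos ⟨rfl, fun h => h2 (add_right_cancel (h.1 h1))⟩]
    · rw [if_neg h1, if_pos h2, if_pos ⟨rfl, fun h => h1 (h.2 (by rw [h2]))⟩, neg_neg]
    · rw [if_neg h1, if_neg h2,
        if_neg (fun h => h.2 (iff_of_false h1 fun h' => h2 (add_right_cancel h')))]
  · rw [Function.update_of_ne hν,
      if_neg (show ¬(ν = μ ∧ ¬(x μ = s μ + 1 ↔ x μ + 1 = s μ + 1)) from fun h => hν h.1)]

variable [NeZero L]

/-- Moving the `μ`-seam anywhere does not change the Wilson fermion determinant. [folklore] -/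
theorem fermionDet_wilsonDirac_apTwistAt_update (s : Fin 4 → ZMod L) (μ : Fin 4) (v : ZMod L)
    (V : GaugeConfig 4 L 𝕌) (m r : ℝ) :
    fermionDet (wilsonDirac (unitaryFundamentalRep (Fin N) ℂ)
        (apTwistAt (Function.update s μ v) V) m r) =
      fermionDet (wilsonDirac (unitaryFundamentalRep (Fin N) ℂ) (apTwistAt s V) m r) := by
  obtain ⟨n, rfl⟩ : ∃ n : ℕ, v = s μ + n :=
    ⟨(v - s μ).val, by rw [ZMod.natCast_zmod_val, add_sub_cancel]⟩
  induction n with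
  | zero => rw [Nat.cast_zero, add_zero, Function.update_eq_self]
  | succ n ih =>
    have h : Function.update s μ (s μ + (n + 1 : ℕ)) =
        Function.update (Function.update s μ (s μ + n)) μ
          (Function.update s μ (s μ + n) μ + 1) := by
      rw [Function.update_self, Function.update_idem, Nat.cast_succ, add_assoc]
    rw [h, apTwistAt_update_succ, fermionDet_wilsonDirac_gaugeTransform, ih]

/-- **Seam independence of the antiperiodic determinant**: the Wilson fermion determinant of the
sign-twisted `U(N)` field does not depend on where the four seams are placed (any two placements
differ by a `{±1}`-valued gauge transformation). [folklore] -/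
theorem fermionDet_wilsonDirac_apTwistAt (s t : Fin 4 → ZMod L) (V : GaugeConfig 4 L 𝕌)
    (m r : ℝ) :
    fermionDet (wilsonDirac (unitaryFundamentalRep (Fin N) ℂ) (apTwistAt s V) m r) =
      fermionDet (wilsonDirac (unitaryFundamentalRep (Fin N) ℂ) (apTwistAt t V) m r) := by
  have hs : s = Function.update (Function.update (Function.update (Function.update t 0 (s 0))
      1 (s 1)) 2 (s 2)) 3 (s 3) := by
    funext μ
    fin_cases μ <;> simp
  rw [hs, fermionDet_wilsonDirac_apTwistAt_update, fermionDet_wilsonDirac_apTwistAt_update,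
    fermionDet_wilsonDirac_apTwistAt_update, fermionDet_wilsonDirac_apTwistAt_update]

/-- **Seam independence of `det D_AP`**: twisting the plain `U(N)` lift of `U` with the seams at
any slices `s` gives the same determinant as `wilsonDiracAP` (seams at `-1`). [folklore] -/
theorem fermionDet_wilsonDirac_apTwistAt_unitaryLift (s : Fin 4 → ZMod L)
    (U : GaugeConfig 4 L 𝕊𝕌) (m : ℝ) :
    fermionDet (wilsonDirac (unitaryFundamentalRep (Fin N) ℂ) (apTwistAt s (unitaryLift U)) m 1) =
      fermionDet (wilsonDiracAP U m) := by
  rw [wilsonDiracAP_def, apLift_eq_apTwistAt]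
  exact fermionDet_wilsonDirac_apTwistAt _ _ _ _ _

end Seam

/-! ### Reflections and translations of the torus -/

section SpinFlip

/-- **The spin flip `α ↦ 3 - α` implements the time reflection on spinors**: in the chiral basis
(Montvay–Münster (8.8), (8.10)) the permutation matrix of `Fin.rev` is `σˣ ⊗ σˣ` (a multiple of
`γ₀γ₅`), which anticommutes with `γ₀` and commutes with `γ₁, γ₂, γ₃`:
`(γ_μ)_{3-α,3-β} = ∓(γ_μ)_{αβ}` with the minus sign exactly for `μ = 0`. [cite: MontvayMunster1994, App. 8.1.2 (8.8)–(8.10)] -/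
theorem euclideanGamma_rev_rev (μ α β : Fin 4) :
    euclideanGamma μ α.rev β.rev =
      if μ = 0 then -euclideanGamma μ α β else euclideanGamma μ α β := by
  fin_cases μ <;> fin_cases α <;> fin_cases β <;>
    simp [euclideanGamma, QuantumLattice.spinHalfPauli, Matrix.kroneckerMap_apply, finProdFinEquiv,
      Fin.divNat, Fin.modNat, Fin.rev]

/-- The Wilson projector `r - γ_μ` under the spin flip: it becomes `r + γ₀` for `μ = 0` and is
unchanged otherwise. [cite: MontvayMunster1994, App. 8.1.2 (8.8)–(8.10)] -/
theorem wilsonProjMinus_rev_rev (r : ℝ) (μ α β : Fin 4) :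
    ((r : ℂ) • (1 : Matrix (Fin 4) (Fin 4) ℂ) - euclideanGamma μ) α.rev β.rev =
      if μ = 0 then ((r : ℂ) • (1 : Matrix (Fin 4) (Fin 4) ℂ) + euclideanGamma μ) α β
      else ((r : ℂ) • (1 : Matrix (Fin 4) (Fin 4) ℂ) - euclideanGamma μ) α β := by
  simp only [Matrix.sub_apply, Matrix.add_apply, Matrix.smul_apply, Matrix.one_apply,
    Fin.rev_inj, euclideanGamma_rev_rev]
  split_ifs <;> ring

/-- The Wilson projector `r + γ_μ` under the spin flip. [cite: MontvayMunster1994, App. 8.1.2 (8.8)–(8.10)] -/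
theorem wilsonProjPlus_rev_rev (r : ℝ) (μ α β : Fin 4) :
    ((r : ℂ) • (1 : Matrix (Fin 4) (Fin 4) ℂ) + euclideanGamma μ) α.rev β.rev =
      if μ = 0 then ((r : ℂ) • (1 : Matrix (Fin 4) (Fin 4) ℂ) - euclideanGamma μ) α β
      else ((r : ℂ) • (1 : Matrix (Fin 4) (Fin 4) ℂ) + euclideanGamma μ) α β := by
  simp only [Matrix.sub_apply, Matrix.add_apply, Matrix.smul_apply, Matrix.one_apply,
    Fin.rev_inj, euclideanGamma_rev_rev]
  split_ifs <;> ring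

end SpinFlip

section Reflection

variable {G : Type*} [Group G] (ρ : G →* Matrix (Fin N) (Fin N) ℂ)

/-- The index map of a time reflection on site × colour × spin: sites by `θ`, spins by the flip
`α ↦ 3 - α`, colours fixed. [folklore] -/
def reflectIndex (θ : TorusSite 4 L → TorusSite 4 L) (p : TorusSite 4 L × Fin N × Fin 4) :
    TorusSite 4 L × Fin N × Fin 4 :=
  (θ p.1, p.2.1, p.2.2.rev)

/-- `reflectIndex` of a permutation of the sites, as a permutation. [folklore] -/
def reflectEquiv (θ : Equiv.Perm (TorusSite 4 L)) : Equiv.Perm (TorusSite 4 L × Fin N × Fin 4) :=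
  θ.prodCongr ((Equiv.refl (Fin N)).prodCongr Fin.revPerm)

/-- `reflectEquiv` is `reflectIndex` as a function. [folklore] -/
theorem coe_reflectEquiv (θ : Equiv.Perm (TorusSite 4 L)) :
    ⇑(reflectEquiv (N := N) θ) = reflectIndex θ := rfl

/-- **Reflection covariance of the Wilson–Dirac operator** (abstract form).  Let `θ` be an
involution of the sites which commutes with the spatial shifts and reverses the time shift
(`θ x = θ y + ê₀ ↔ y = x + ê₀`), and let `V` be the reflected gauge field of `U`:
`V(x, 0) = U(θ(x + ê₀), 0)⁻¹`, `V(x, k) = U(θ x, k)` (`k ≠ 0`).  Then `D_W[V]` is `D_W[U]` reindexed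
by `(x, a, α) ↦ (θ x, a, 3 - α)` on both sides: the time-like forward and backward hops are
exchanged, which the spin flip compensates (`r ∓ γ₀ ↦ r ± γ₀`).  Both the link reflection
`GaugeConfig.timeReflect` and the site reflection of `TorusSiteRP` are instances
(Osterwalder–Seiler 1978 §2; Montvay–Münster §4.2.3 (4.91), (4.99)). [cite: MontvayMunster1994, §4.2.3 (4.91) and (4.99)] -/
theorem wilsonDirac_reflect (θ : TorusSite 4 L → TorusSite 4 L) (hθ : Function.Involutive θ)
    (hθ0 : ∀ x y, θ x = Site.shift (θ y) 0 ↔ y = Site.shift x 0)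
    (hθk : ∀ x (k : Fin 4), k ≠ 0 → θ (Site.shift x k) = Site.shift (θ x) k)
    (U V : GaugeConfig 4 L G) (hV0 : ∀ x, V (x, 0) = (U (θ (Site.shift x 0), 0))⁻¹)
    (hVk : ∀ x k, k ≠ 0 → V (x, k) = U (θ x, k)) (m r : ℝ) :
    wilsonDirac ρ V m r = (wilsonDirac ρ U m r).submatrix (reflectIndex θ) (reflectIndex θ) := by
  ext ⟨x, a, α⟩ ⟨y, b, β⟩
  simp only [Matrix.submatrix_apply, reflectIndex, wilsonDirac, Matrix.of_apply]
  congr 1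
  · simp only [Prod.mk.injEq, hθ.injective.eq_iff, Fin.rev_inj]
  · congr 1
    refine Finset.sum_congr rfl fun μ _ => ?_
    by_cases hμ : μ = 0
    · subst hμ
      rw [add_comm]
      congr 1
      · simp only [hθ0 y x]
        split_ifs with h
        · subst h
          rw [wilsonProjMinus_rev_rev, if_pos rfl, hV0, inv_inv]
        · rfl
      · simp only [hθ0 x y]
        split_ifs with h
        · subst h
          rw [wilsonProjPlus_rev_rev, if_pos rfl, hV0]
        · rfl
    · have h1 : θ y = Site.shift (θ x) μ ↔ y = Site.shift x μ := by
        rw [← hθk x μ hμ, hθ.injective.eq_iff]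
      have h2 : θ x = Site.shift (θ y) μ ↔ x = Site.shift y μ := by
        rw [← hθk y μ hμ, hθ.injective.eq_iff]
      simp only [h1, h2]
      congr 1
      · split_ifs with h
        · rw [wilsonProjMinus_rev_rev, if_neg hμ, hVk x μ hμ]
        · rfl
      · split_ifs with h
        · rw [wilsonProjPlus_rev_rev, if_neg hμ, hVk y μ hμ]
        · rfl

/-- **Reflection invariance of the Wilson fermion determinant** (abstract form of
`wilsonDirac_reflect`): `det D_W[V] = det D_W[U]`. [cite: MontvayMunster1994, §4.2.3 (4.91) and (4.99)] -/
theorem fermionDet_wilsonDirac_reflect [NeZero L] (θ : TorusSite 4 L → TorusSite 4 L)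
    (hθ : Function.Involutive θ)
    (hθ0 : ∀ x y, θ x = Site.shift (θ y) 0 ↔ y = Site.shift x 0)
    (hθk : ∀ x (k : Fin 4), k ≠ 0 → θ (Site.shift x k) = Site.shift (θ x) k)
    (U V : GaugeConfig 4 L G) (hV0 : ∀ x, V (x, 0) = (U (θ (Site.shift x 0), 0))⁻¹)
    (hVk : ∀ x k, k ≠ 0 → V (x, k) = U (θ x, k)) (m r : ℝ) :
    fermionDet (wilsonDirac ρ V m r) = fermionDet (wilsonDirac ρ U m r) := by
  rw [wilsonDirac_reflect ρ θ hθ hθ0 hθk U V hV0 hVk m r]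
  exact Matrix.det_submatrix_equiv_self (reflectEquiv (N := N) (hθ.toPerm θ)) _

/-! #### Coordinates -/

/-- Two sites agree iff their time coordinates and their spatial coordinates agree. [folklore] -/
private theorem site_ext_iff0 {x y : TorusSite 4 L} : x = y ↔ x 0 = y 0 ∧ ∀ k, k ≠ 0 → x k = y k :=
  ⟨fun h => by subst h; exact ⟨rfl, fun _ _ => rfl⟩,
    fun h => funext fun k => if hk : k = 0 then hk ▸ h.1 else h.2 k hk⟩

/-- Time coordinate of the link reflection: `(θ x)₀ = 1 - x₀`. [cite: OsterwalderSeiler1978, §2] -/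
private theorem timeReflect_apply_zero' (x : TorusSite 4 L) : Site.timeReflect x 0 = 1 - x 0 := by
  simp [Site.timeReflect]

/-- The link reflection fixes the spatial coordinates. [cite: OsterwalderSeiler1978, §2] -/
private theorem timeReflect_apply_of_ne' (x : TorusSite 4 L) {k : Fin 4} (hk : k ≠ 0) :
    Site.timeReflect x k = x k := by
  simp [Site.timeReflect, hk]

/-- The link reflection `θ(t, x⃗) = (1 - t, x⃗)` of sites is an involution. [cite: OsterwalderSeiler1978, §2] -/
theorem timeReflect_involutive' :
    Function.Involutive (Site.timeReflect : TorusSite 4 L → TorusSite 4 L) := fun x => by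
  rw [site_ext_iff0]
  refine ⟨?_, fun k hk => ?_⟩
  · rw [timeReflect_apply_zero', timeReflect_apply_zero', sub_sub_cancel]
  · rw [timeReflect_apply_of_ne' _ hk, timeReflect_apply_of_ne' _ hk]

/-- The link reflection reverses the time shift: `θ x = θ y + ê₀ ↔ y = x + ê₀`. [folklore] -/
theorem timeReflect_eq_shift_iff (x y : TorusSite 4 L) :
    Site.timeReflect x = Site.shift (Site.timeReflect y) 0 ↔ y = Site.shift x 0 := by
  rw [site_ext_iff0, site_ext_iff0, shift_apply_self', timeReflect_apply_zero', shift_apply_self',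
    timeReflect_apply_zero']
  refine and_congr ⟨fun h => ?_, fun h => ?_⟩ (forall_congr' fun k => imp_congr_right fun hk => ?_)
  · linear_combination h
  · linear_combination h
  · rw [timeReflect_apply_of_ne' _ hk, shift_apply_of_ne' _ hk, timeReflect_apply_of_ne' _ hk,
      shift_apply_of_ne' _ hk, eq_comm]

/-- The link reflection commutes with spatial shifts. [folklore] -/
theorem timeReflect_shift_of_ne (x : TorusSite 4 L) {k : Fin 4} (hk : k ≠ 0) :
    Site.timeReflect (Site.shift x k) = Site.shift (Site.timeReflect x) k := by
  rw [site_ext_iff0]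
  refine ⟨?_, fun j hj => ?_⟩
  · rw [timeReflect_apply_zero', shift_apply_of_ne' _ hk.symm, shift_apply_of_ne' _ hk.symm,
      timeReflect_apply_zero']
  · rw [timeReflect_apply_of_ne' _ hj]
    by_cases hjk : j = k
    · subst hjk
      rw [shift_apply_self', shift_apply_self', timeReflect_apply_of_ne' _ hj]
    · rw [shift_apply_of_ne' _ hjk, shift_apply_of_ne' _ hjk, timeReflect_apply_of_ne' _ hj]

/-- The site reflection `θ₀(t, x⃗) = (-t, x⃗)` in the lattice hyperplanes `t = 0, L/2`
(`TorusSiteRP`: `θ₀ x = θ x - ê₀`). [cite: OsterwalderSeiler1978, §2] -/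
def siteTimeNeg (x : TorusSite 4 L) : TorusSite 4 L :=
  Function.update x 0 (-x 0)

/-- Time coordinate of the site reflection: `(θ₀ x)₀ = -x₀`. [cite: OsterwalderSeiler1978, §2] -/
@[simp] theorem siteTimeNeg_apply_zero (x : TorusSite 4 L) : siteTimeNeg x 0 = -x 0 := by
  simp [siteTimeNeg]

/-- The site reflection fixes the spatial coordinates. [cite: OsterwalderSeiler1978, §2] -/
theorem siteTimeNeg_apply_of_ne (x : TorusSite 4 L) {k : Fin 4} (hk : k ≠ 0) :
    siteTimeNeg x k = x k := by
  simp [siteTimeNeg, hk]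

/-- `θ x - ê₀ = θ₀ x`. [folklore] -/
theorem timeReflect_sub_single (x : TorusSite 4 L) :
    Site.timeReflect x - Pi.single 0 1 = siteTimeNeg x := by
  rw [site_ext_iff0]
  refine ⟨?_, fun k hk => ?_⟩
  · rw [Pi.sub_apply, timeReflect_apply_zero', siteTimeNeg_apply_zero, Pi.single_eq_same]
    ring
  · rw [Pi.sub_apply, timeReflect_apply_of_ne' _ hk, siteTimeNeg_apply_of_ne _ hk,
      Pi.single_eq_of_ne hk, sub_zero]

/-- `θ₀` is an involution. [folklore] -/
theorem siteTimeNeg_involutive : Function.Involutive (siteTimeNeg : TorusSite 4 L → TorusSite 4 L) :=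
  fun x => by
  rw [site_ext_iff0]
  refine ⟨?_, fun k hk => ?_⟩
  · rw [siteTimeNeg_apply_zero, siteTimeNeg_apply_zero, neg_neg]
  · rw [siteTimeNeg_apply_of_ne _ hk, siteTimeNeg_apply_of_ne _ hk]

/-- `θ₀` reverses the time shift. [folklore] -/
theorem siteTimeNeg_eq_shift_iff (x y : TorusSite 4 L) :
    siteTimeNeg x = Site.shift (siteTimeNeg y) 0 ↔ y = Site.shift x 0 := by
  rw [site_ext_iff0, site_ext_iff0, shift_apply_self', siteTimeNeg_apply_zero, shift_apply_self',
    siteTimeNeg_apply_zero]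
  refine and_congr ⟨fun h => ?_, fun h => ?_⟩ (forall_congr' fun k => imp_congr_right fun hk => ?_)
  · linear_combination h
  · linear_combination h
  · rw [siteTimeNeg_apply_of_ne _ hk, shift_apply_of_ne' _ hk, siteTimeNeg_apply_of_ne _ hk,
      shift_apply_of_ne' _ hk, eq_comm]

/-- `θ₀` commutes with spatial shifts. [folklore] -/
theorem siteTimeNeg_shift_of_ne (x : TorusSite 4 L) {k : Fin 4} (hk : k ≠ 0) :
    siteTimeNeg (Site.shift x k) = Site.shift (siteTimeNeg x) k := by
  rw [site_ext_iff0]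
  refine ⟨?_, fun j hj => ?_⟩
  · rw [siteTimeNeg_apply_zero, shift_apply_of_ne' _ hk.symm, shift_apply_of_ne' _ hk.symm,
      siteTimeNeg_apply_zero]
  · rw [siteTimeNeg_apply_of_ne _ hj]
    by_cases hjk : j = k
    · subst hjk
      rw [shift_apply_self', shift_apply_self', siteTimeNeg_apply_of_ne _ hj]
    · rw [shift_apply_of_ne' _ hjk, shift_apply_of_ne' _ hjk, siteTimeNeg_apply_of_ne _ hj]

/-- The site reflection `Θ₀ U = Θ(τ_{ê₀} U)` of `TorusSiteRP` on links, through `θ₀`: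
time-like links `(x, 0) ↦ U(θ₀(x + ê₀), 0)⁻¹`, spatial links `(x, k) ↦ U(θ₀ x, k)`. [cite: OsterwalderSeiler1978, §2] -/
theorem siteReflect_apply' [MeasurableSpace G] (U : GaugeConfig 4 L G) (e : Edge 4 L) :
    (torusConfigShift (Pi.single (0 : Fin 4) (1 : ZMod L)) U).timeReflect e =
      if e.2 = 0 then (U (siteTimeNeg (Site.shift e.1 0), 0))⁻¹ else U (siteTimeNeg e.1, e.2) := by
  simp only [GaugeConfig.timeReflect, torusConfigShift_apply, timeReflect_sub_single]

/-- **Translation covariance of the Wilson–Dirac operator**: `D_W[τ_v U]` is `D_W[U]` reindexed by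
`(x, a, α) ↦ (x - v, a, α)`. [folklore] -/
theorem wilsonDirac_torusConfigShift [MeasurableSpace G] (v : TorusSite 4 L) (U : GaugeConfig 4 L G)
    (m r : ℝ) :
    wilsonDirac ρ (torusConfigShift v U) m r =
      (wilsonDirac ρ U m r).submatrix (fun p => (p.1 - v, p.2)) (fun p => (p.1 - v, p.2)) := by
  have hs : ∀ (x : TorusSite 4 L) (μ : Fin 4), Site.shift (x - v) μ = Site.shift x μ - v :=
    fun x μ => by simp only [QuantumFieldTheory.Site.shift, add_sub_right_comm]
  ext ⟨x, a, α⟩ ⟨y, b, β⟩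
  simp only [Matrix.submatrix_apply, wilsonDirac, Matrix.of_apply, torusConfigShift_apply,
    Prod.mk.injEq, hs, sub_left_inj]

variable [NeZero L]

/-- **The Wilson fermion determinant is invariant under the link reflection `Θ`**
(`GaugeConfig.timeReflect`, reflection in the hyperplane between time slices). [cite: MontvayMunster1994, §4.2.3 (4.91)] -/
theorem fermionDet_wilsonDirac_timeReflect (U : GaugeConfig 4 L G) (m r : ℝ) :
    fermionDet (wilsonDirac ρ U.timeReflect m r) = fermionDet (wilsonDirac ρ U m r) :=
  fermionDet_wilsonDirac_reflect ρ Site.timeReflect timeReflect_involutive' timeReflect_eq_shift_iff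
    (fun x k hk => timeReflect_shift_of_ne x hk) U _ (fun x => by simp [GaugeConfig.timeReflect])
    (fun x k hk => by simp [GaugeConfig.timeReflect, hk]) m r

/-- **The Wilson fermion determinant is invariant under the site reflection `Θ₀`**
(`(torusConfigShift ê₀ U).timeReflect`, reflection in the lattice hyperplanes `t = 0, L/2`, as in
`TorusSiteRP`). [cite: MontvayMunster1994, §4.2.3 (4.99)] -/
theorem fermionDet_wilsonDirac_siteReflect [MeasurableSpace G] (U : GaugeConfig 4 L G) (m r : ℝ) :
    fermionDet (wilsonDirac ρ (torusConfigShift (Pi.single (0 : Fin 4) (1 : ZMod L)) U).timeReflect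
        m r) = fermionDet (wilsonDirac ρ U m r) :=
  fermionDet_wilsonDirac_reflect ρ siteTimeNeg siteTimeNeg_involutive siteTimeNeg_eq_shift_iff
    (fun x k hk => siteTimeNeg_shift_of_ne x hk) U _ (fun x => by rw [siteReflect_apply', if_pos rfl])
    (fun x k hk => by rw [siteReflect_apply', if_neg hk]) m r

/-- **Translation invariance of the Wilson fermion determinant.** [folklore] -/
theorem fermionDet_wilsonDirac_torusConfigShift [MeasurableSpace G] (v : TorusSite 4 L)
    (U : GaugeConfig 4 L G) (m r : ℝ) :
    fermionDet (wilsonDirac ρ (torusConfigShift v U) m r) = fermionDet (wilsonDirac ρ U m r) := by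
  rw [wilsonDirac_torusConfigShift]
  exact Matrix.det_submatrix_equiv_self
    ((Equiv.subRight v).prodCongr (Equiv.refl (Fin N × Fin 4))) _

end Reflection

/-! ### Reflections and translations of the antiperiodic operator -/

section ReflectionAP

/-- The plain lift commutes with the link reflection. [folklore] -/
theorem unitaryLift_timeReflect [NeZero d] (U : GaugeConfig d L 𝕊𝕌) :
    unitaryLift (N := N) U.timeReflect = (unitaryLift U).timeReflect := by
  funext e
  simp only [unitaryLift_apply, GaugeConfig.timeReflect]
  split_ifs
  · rw [map_inv]
  · rfl

/-- The plain lift commutes with translations. [folklore] -/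
theorem unitaryLift_torusConfigShift (v : TorusSite d L) (U : GaugeConfig d L 𝕊𝕌) :
    unitaryLift (N := N) (torusConfigShift v U) = torusConfigShift v (unitaryLift U) := by
  funext e
  simp only [unitaryLift_apply, torusConfigShift_apply]

/-- **The link reflection moves the time seam**: `Θ (apTwistAt s V) = apTwistAt s' (Θ V)` with
`s' 0 = -s 0` and `s' k = s k`. [folklore] -/
theorem apTwistAt_timeReflect [NeZero d] (s : Fin d → ZMod L) (V : GaugeConfig d L 𝕌) :
    (apTwistAt s V).timeReflect = apTwistAt (Function.update s 0 (-s 0)) V.timeReflect := by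
  funext ⟨x, μ⟩
  simp only [GaugeConfig.timeReflect, apTwistAt_apply]
  by_cases hμ : μ = 0
  · subst hμ
    simp only [if_true, Function.update_self]
    have h0 : Site.timeReflect (Site.shift x 0) 0 = -x 0 := by
      simp [Site.timeReflect, QuantumFieldTheory.Site.shift]
    simp only [h0, neg_eq_iff_eq_neg]
    split_ifs
    · exact unitary_neg_inv _
    · rfl
  · have hk : Site.timeReflect x μ = x μ := by simp [Site.timeReflect, hμ]
    simp only [if_neg hμ, Function.update_of_ne hμ, hk]

/-- **Translations move all seams**: `τ_v (apTwistAt s V) = apTwistAt (s + v) (τ_v V)`. [folklore] -/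
theorem apTwistAt_torusConfigShift (s : Fin d → ZMod L) (v : TorusSite d L) (V : GaugeConfig d L 𝕌) :
    torusConfigShift v (apTwistAt s V) = apTwistAt (s + v) (torusConfigShift v V) := by
  funext ⟨x, μ⟩
  simp only [torusConfigShift_apply, apTwistAt_apply, Pi.add_apply, Pi.sub_apply, sub_eq_iff_eq_add]

variable [NeZero L]

/-- **`det D_AP` is invariant under the link reflection** `Θ` of the `SU(N)` gauge field. [cite: MontvayMunster1994, §4.2.3 (4.91)] -/
theorem fermionDet_wilsonDiracAP_timeReflect (U : GaugeConfig 4 L 𝕊𝕌) (m : ℝ) :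
    fermionDet (wilsonDiracAP U.timeReflect m) = fermionDet (wilsonDiracAP U m) := by
  rw [wilsonDiracAP_def, apLift_eq_apTwistAt, unitaryLift_timeReflect,
    fermionDet_wilsonDirac_apTwistAt _ (Function.update (fun _ : Fin 4 => (-1 : ZMod L)) 0
      (-(fun _ : Fin 4 => (-1 : ZMod L)) 0)),
    ← apTwistAt_timeReflect, fermionDet_wilsonDirac_timeReflect, ← apLift_eq_apTwistAt,
    ← wilsonDiracAP_def]

/-- **`det D_AP` is invariant under the site reflection `Θ₀ U = Θ(τ_{ê₀} U)`** of `TorusSiteRP`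
(reflection in the lattice hyperplanes `t = 0, L/2`): the reflected antiperiodic field is, up to a
relocation of the time seam, the antiperiodic lift of the reflected field. [cite: MontvayMunster1994, §4.2.3 (4.99)] -/
theorem fermionDet_wilsonDiracAP_siteReflect (U : GaugeConfig 4 L 𝕊𝕌) (m : ℝ) :
    fermionDet (wilsonDiracAP
        (torusConfigShift (Pi.single (0 : Fin 4) (1 : ZMod L)) U).timeReflect m) =
      fermionDet (wilsonDiracAP U m) := by
  set c : Fin 4 → ZMod L := fun _ => -1 with hc
  rw [wilsonDiracAP_def, apLift_eq_apTwistAt, ← hc, unitaryLift_timeReflect,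
    unitaryLift_torusConfigShift,
    fermionDet_wilsonDirac_apTwistAt c
      (Function.update (c + Pi.single (0 : Fin 4) (1 : ZMod L)) 0
        (-(c + Pi.single (0 : Fin 4) (1 : ZMod L) : Fin 4 → ZMod L) 0)),
    ← apTwistAt_timeReflect, ← apTwistAt_torusConfigShift, fermionDet_wilsonDirac_siteReflect,
    wilsonDiracAP_def, apLift_eq_apTwistAt]

/-- **`det D_AP` is translation invariant.** [folklore] -/
theorem fermionDet_wilsonDiracAP_torusConfigShift (v : TorusSite 4 L) (U : GaugeConfig 4 L 𝕊𝕌)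
    (m : ℝ) : fermionDet (wilsonDiracAP (torusConfigShift v U) m) = fermionDet (wilsonDiracAP U m) := by
  set c : Fin 4 → ZMod L := fun _ => -1 with hc
  rw [wilsonDiracAP_def, apLift_eq_apTwistAt, ← hc, unitaryLift_torusConfigShift,
    fermionDet_wilsonDirac_apTwistAt c (c - v + v), ← apTwistAt_torusConfigShift,
    fermionDet_wilsonDirac_torusConfigShift, fermionDet_wilsonDirac_apTwistAt (c - v) c,
    wilsonDiracAP_def, apLift_eq_apTwistAt]

end ReflectionAP

end QLatticeAQFT

end Literature.MathematicalPhysics.QuantumLattice
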